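import Mathlib
import HarnessLib
import Summits.HubbardSuperconductivity.HubbardSuperconductivity.Theorems.KLProgrammeKLRegimeTwoVolumeLipBornDiffStep

/-!
# Route `KLProgramme` — crux K3 ENGINE (stmt-HubbardSuperconductivity-20437), stub (e) proof-input «(e)-D-ROWS»: THE (Db) ROW WITH A FREE INPUT-DIFFERENCE PROFILE
# (seat hubbard-kl-k3c4-p1 g24; `--supports` 20437; companion of `…TwoVolumeLipBornDiffStep`)

`…TwoVolumeLipBornDiffStep.klLipBornDiff_pinned_le_step` reads the LIP door at the deep-pin sizes `E m′ := klLipInputDiffSup … d k (2m′) R` themselves.  The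
T3-Lip₄ assembly (`EngineV8.towerBornDiff_le_law₄`) needs the same row at ANY majorant `E m′ ≥ klLipInputDiffSup … (2m′) R`: the (Dμ) row
(`…LipRemeasureSup.klLipInputDiffSup_le_remeasured`) bounds the sizes by `E⁰ + Eˢ` — `E⁰` the transferred born differences of the earlier blocks (T3-Lip₄'s
source-free `dμ` row) and `Eˢ` the re-measurement sources (base row, far tails; routed through T3-Lip₄'s `src` slot with the law kit of `…TwoVolumeLipSourceLaw`) —
and the door's right side is additive in the slot that carries `E`.  The door `…LipBlockStepDeep.lipBlockStep_deep_le` takes its deep-pin profile as a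
hypothesis `≤ E m′`, so the generalisation is literal (`sum_pinned_norm_kernel_inputDiff_le_sup … ≤ klLipInputDiffSup ≤ E`).

* `klLipBornDiff_pinned_le_step_of_profile` — pin level; `klLipBornDiffSup_le_step_of_profile` — sup form (`B ≥ LIP(E) + SRC`, `0 ≤ B`).

A composition of landed theorems; nothing asserts the (D) rows, stub (e), VL, K3 or superconductivity.
References: BGM 2006 §2.8 (2.76)–(2.90), §3 [cite: BenfattoGiulianiMastropietro2006].
-/

noncomputable section

namespace Summit.HubbardSuperconductivity.HubbardSuperconductivity.Theorems.TwoVolumeLip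

set_option linter.dupNamespace false -- summit = problem name (single-conjunct summit), D-0017

open Finset Literature.MathematicalPhysics.QuantumLattice GrassmannAlgebra Literature.Probability.LatticeModels
  Literature.Probability.LatticeModels.BattleFederbush
open Literature.MathematicalPhysics.QuantumLattice.FermiRG
open Summit.HubbardSuperconductivity.HubbardSuperconductivity.Theorems.KLRegimeSplit
open Summit.HubbardSuperconductivity.HubbardSuperconductivity.Theorems.KLProgrammeLegKernels
open Summit.HubbardSuperconductivity.HubbardSuperconductivity.Theorems.DispersionFlow
open Summit.HubbardSuperconductivity.HubbardSuperconductivity.Theorems.EngineV8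
open Summit.HubbardSuperconductivity.HubbardSuperconductivity.Theorems.TwoVolumeSource
open Summit.HubbardSuperconductivity.HubbardSuperconductivity.Theorems.TwoVolumeDefect

variable {L b M : ℕ} [NeZero L] [NeZero (b * L)] [NeZero M]

set_option maxHeartbeats 400000 in -- two large door applications in one declaration
/-- **The (Db) row at a deep pin, free profile.**  `klLipBornDiff_pinned_le_step` with the deep-pin sizes `klLipInputDiffSup … (2m′) R` replaced by ANY
majorant `E m′ ≥ 0` of them (the door is monotone in its profile hypothesis): the form the T3-Lip₄ assembly uses, splitting `E = E⁰ + Eˢ` into the pure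
re-measured born differences `E⁰` (T3-Lip₄'s `dμ`) and the re-measurement sources `Eˢ` (routed through the `src` slot).  Original docstring:  Block `k` (`1 ≤ dk`), `0 < β`, `Z^K_{bL,Λ_{dk}}, Z^K_{L,Λ_{dk}} ≠ 0`; LIP data of `lipBlockStep_deep_le` (Gram constant `κ` and
`klGluedWt`-weighted rows `α` of the fine block covariance, weighted profiles `NV` of the glued coarse input and `ND` of the input difference, smallness `θ₁, θ₂`
at the majorants built with `E m′ := klLipInputDiffSup … (2m′) R`, truncation `N₀`, admissible `0 < Λ ≤ 1 + Λ_{dk−1}(R′+1)`); E1-currency rows of the block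
transfer (`klScaleWt (bL) M β j_r`-weighted row / column sums of `klLipTransfer (bL)` at most `cW`, `0 ≤ Λ_T ≤ Λ_{j_r}`); SRC data (coarse born profiles `N`, `N_far`
and source-defect profiles `Es` at `D₀`-deep pins, `NDs` everywhere, in degree `n+1`); depths `2r ≤ D₀`, `R + R′ ≤ D₀`; output degree `n + 1 = 2q`, leg `p`,
output pin `w″ ∈ klDeepPins L (D₀ + r)`.  Then the pinned kernel sum of `klLipBornDiff … d k` at `(p, w″)` is at most LIP + SRC (displayed). -/
theorem klLipBornDiff_pinned_le_step_of_profile {β : ℝ} (hβ : 0 < β) (U μ : ℝ) (K : TrigPolyC4v) {d k : ℕ} (hdk : 1 ≤ d * k)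
    (hZf : hubbardEffPartitionFnCT (b * L) M β U μ 0 K (klScale klE0 (d * k)) ≠ 0)
    (hZc : hubbardEffPartitionFnCT L M β U μ 0 K (klScale klE0 (d * k)) ≠ 0)
    {κ : ℝ} (hκ : 0 < κ) (hGB : IsGramBoundedR ((sectorSubMatrix (b * L) M β (bgmFatMultiplier (b * L) M klE0 β (nambuXiCT (b * L) μ K) (d * k - 1))).transpose * hubbardCovSliceCT (b * L) M β μ 0 K (klScale klE0 (d * (k + 1))) (klScale klE0 (d * k)) * sectorSubMatrix (b * L) M β (bgmFatMultiplier (b * L) M klE0 β (nambuXiCT (b * L) μ K) (d * k - 1))) κ)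
    (NV ND : ℕ → ℝ) (hNV0 : ∀ m', 0 ≤ NV m') (hND0 : ∀ m', 0 ≤ ND m')
    (hNV : ∀ m' (j : Fin (2 * m')) (x : (SpaceTimeIdx (b * L) M × SectorLeg (sectorCount (d * k - 1)))), ∑ Y ∈ univ.filter (fun Y : Fin (2 * m') → (SpaceTimeIdx (b * L) M × SectorLeg (sectorCount (d * k - 1))) => Y j = x),
      ‖kernel ℂ (klGlue L b M (sectorCount (d * k - 1)) (klLipInput L M β U μ K d k)) (2 * m') Y‖ * klGluedWt L b M β (d * k - 1) (sectorCount (d * k - 1)) (univ.image Y) ≤ NV m')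
    (hND : ∀ m' (j : Fin (2 * m')) (x : (SpaceTimeIdx (b * L) M × SectorLeg (sectorCount (d * k - 1)))), ∑ Y ∈ univ.filter (fun Y : Fin (2 * m') → (SpaceTimeIdx (b * L) M × SectorLeg (sectorCount (d * k - 1))) => Y j = x),
      ‖kernel ℂ (klLipInputDiff L b M β U μ K d k) (2 * m') Y‖ * klGluedWt L b M β (d * k - 1) (sectorCount (d * k - 1)) (univ.image Y) ≤ ND m')
    (R R' : ℕ) (E : ℕ → ℝ) (hE0 : ∀ m', 0 ≤ E m') (hE : ∀ m', klLipInputDiffSup L b M β U μ K d k (2 * m') R ≤ E m')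
    {α : ℝ} (hα : 0 < α)
    (hrow : ∀ X, ∑ Y, ‖((sectorSubMatrix (b * L) M β (bgmFatMultiplier (b * L) M klE0 β (nambuXiCT (b * L) μ K) (d * k - 1))).transpose * hubbardCovSliceCT (b * L) M β μ 0 K (klScale klE0 (d * (k + 1))) (klScale klE0 (d * k)) * sectorSubMatrix (b * L) M β (bgmFatMultiplier (b * L) M klE0 β (nambuXiCT (b * L) μ K) (d * k - 1))) X Y‖ * klGluedWt L b M β (d * k - 1) (sectorCount (d * k - 1)) {X, Y} ≤ α)
    (hcol : ∀ Y, ∑ X, ‖((sectorSubMatrix (b * L) M β (bgmFatMultiplier (b * L) M klE0 β (nambuXiCT (b * L) μ K) (d * k - 1))).transpose * hubbardCovSliceCT (b * L) M β μ 0 K (klScale klE0 (d * (k + 1))) (klScale klE0 (d * k)) * sectorSubMatrix (b * L) M β (bgmFatMultiplier (b * L) M klE0 β (nambuXiCT (b * L) μ K) (d * k - 1))) X Y‖ * klGluedWt L b M β (d * k - 1) (sectorCount (d * k - 1)) {X, Y} ≤ α)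
    {ρ : ℝ} (hρ : 0 < ρ)
    (hθ₁ : Real.exp 1 * α * normV (SpaceTimeIdx (b * L) M × SectorLeg (sectorCount (d * k - 1))) κ ρ (fun m' => NV m' + ND m' + E m') / κ ^ 2 < 1)
    (hθ₂ : Real.exp 1 * α * normV (SpaceTimeIdx (b * L) M × SectorLeg (sectorCount (d * k - 1))) κ ρ (fun m' => NV m' + ND m') / κ ^ 2 < 1)
    {N₀ : ℕ} (hN₀ : 2 ≤ N₀)
    {Λ : ℝ} (hΛ0 : 0 < Λ) (hΛle : Λ ≤ 1 + klScale klE0 (d * k - 1) * ((R' : ℝ) + 1))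
    (jr : ℕ) {ΛT cW : ℝ} (hΛT : 0 ≤ ΛT) (hΛr : ΛT ≤ klScale klE0 jr) (hcW : 0 ≤ cW)
    (hrowT : ∀ x, ∑ y', ‖klLipTransfer (b * L) M β μ K d k x y'‖ *
      klScaleWt (b * L) M β jr {latticeLegPos (2 * (2 * M)) x, latticeLegPos (2 * (2 * M)) y'} ≤ cW)
    (hcolT : ∀ y', ∑ x, ‖klLipTransfer (b * L) M β μ K d k x y'‖ *
      klScaleWt (b * L) M β jr {latticeLegPos (2 * (2 * M)) x, latticeLegPos (2 * (2 * M)) y'} ≤ cW)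
    (D₀ r : ℕ) (hD₀ : 2 * r ≤ D₀) (hRR' : R + R' ≤ D₀)
    {n q : ℕ} (hq : 2 * q = n + 1)
    {N Nfar Es NDs : ℝ} (hN0 : 0 ≤ N) (hNfar0 : 0 ≤ Nfar) (hEs0 : 0 ≤ Es) (hNDs0 : 0 ≤ NDs)
    (hN : ∀ (p : Fin (n + 1)) y, ∑ Y ∈ univ.filter (fun Y : Fin (n + 1) → SpaceTimeIdx L M × SectorLeg (sectorCount (d * k - 1)) => Y p = y),
      ‖kernel ℂ (effAction ℂ (klLipCov L M β μ K d k) (klLipInput L M β U μ K d k) - klLipInput L M β U μ K d k) (n + 1) Y‖ ≤ N)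
    (hNfar : ∀ (p : Fin (n + 1)) y (i : Fin (n + 1)),
      ∑ Y ∈ univ.filter (fun Y : Fin (n + 1) → SpaceTimeIdx L M × SectorLeg (sectorCount (d * k - 1)) => Y p = y ∧ r < Torus.tnorm ((Y p).1.2 - (Y i).1.2)),
        ‖kernel ℂ (effAction ℂ (klLipCov L M β μ K d k) (klLipInput L M β U μ K d k) - klLipInput L M β U μ K d k) (n + 1) Y‖ ≤ Nfar)
    (hEs : ∀ (p : Fin (n + 1)) (y' : SpaceTimeIdx (b * L) M × SectorLeg (sectorCount (d * k - 1))), y' ∈ klDeepPins L D₀ →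
      ∑ Y' ∈ univ.filter (fun Y' : Fin (n + 1) → SpaceTimeIdx (b * L) M × SectorLeg (sectorCount (d * k - 1)) => Y' p = y'),
        ‖kernel ℂ ((effAction ℂ (klLipCov (b * L) M β μ K d k) (klGlue L b M (sectorCount (d * k - 1)) (klLipInput L M β U μ K d k)) -
              klGlue L b M (sectorCount (d * k - 1)) (klLipInput L M β U μ K d k)) -
            klGlue L b M (sectorCount (d * k - 1))
              (effAction ℂ (klLipCov L M β μ K d k) (klLipInput L M β U μ K d k) - klLipInput L M β U μ K d k)) (n + 1) Y'‖ ≤ Es)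
    (hNDs : ∀ (p : Fin (n + 1)) (y' : SpaceTimeIdx (b * L) M × SectorLeg (sectorCount (d * k - 1))),
      ∑ Y' ∈ univ.filter (fun Y' : Fin (n + 1) → SpaceTimeIdx (b * L) M × SectorLeg (sectorCount (d * k - 1)) => Y' p = y'),
        ‖kernel ℂ ((effAction ℂ (klLipCov (b * L) M β μ K d k) (klGlue L b M (sectorCount (d * k - 1)) (klLipInput L M β U μ K d k)) -
              klGlue L b M (sectorCount (d * k - 1)) (klLipInput L M β U μ K d k)) -
            klGlue L b M (sectorCount (d * k - 1))
              (effAction ℂ (klLipCov L M β μ K d k) (klLipInput L M β U μ K d k) - klLipInput L M β U μ K d k)) (n + 1) Y'‖ ≤ NDs)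
    (p : Fin (n + 1)) (w'' : SpaceTimeIdx (b * L) M × SectorLeg (sectorCount (d * k))) (hw'' : w'' ∈ klDeepPins L (D₀ + r)) :
    ∑ X'' ∈ univ.filter (fun X'' : Fin (n + 1) → SpaceTimeIdx (b * L) M × SectorLeg (sectorCount (d * k)) => X'' p = w''),
        ‖kernel ℂ (klLipBornDiff L b M β U μ K d k) (n + 1) X''‖ ≤
      cW ^ (2 * q - 1) * (cW *
        ((∑ m' ∈ range (Fintype.card (SpaceTimeIdx (b * L) M × SectorLeg (sectorCount (d * k - 1))) / 2 + 1), if q < m' then ((2 * m').choose (2 * q) : ℝ) * κ ^ (2 * m' - 2 * q) * E m' else 0) +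
          Λ⁻¹ * ∑ m' ∈ range (Fintype.card (SpaceTimeIdx (b * L) M × SectorLeg (sectorCount (d * k - 1))) / 2 + 1),
            if q < m' then ((2 * m').choose (2 * q) : ℝ) * κ ^ (2 * m' - 2 * q) * ND m' else 0) +
        cW / (1 + ΛT * ((r : ℝ) + 1)) * ∑ m' ∈ range (Fintype.card (SpaceTimeIdx (b * L) M × SectorLeg (sectorCount (d * k - 1))) / 2 + 1), if q < m' then ((2 * m').choose (2 * q) : ℝ) * κ ^ (2 * m' - 2 * q) * ND m' else 0) +
      cW ^ (2 * q - 1) * (cW *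
        ((∑ n' ∈ Ico 2 N₀, (ρ⁻¹ ^ (2 * q) * κ⁻¹ ^ (2 * (n' - 1)) * (α ^ (n' - 1) * Real.exp n')) *
            ∑ δ ∈ (Fintype.piFinset fun _ : Fin n' => range (Fintype.card (SpaceTimeIdx (b * L) M × SectorLeg (sectorCount (d * k - 1))) / 2 + 1)) with 2 * q + 2 * (n' - 1) ≤ ∑ a, 2 * δ a,
              ∑ a, (Real.exp 2 * (κ + ρ)) ^ (2 * δ a) * E (δ a) *
                ∏ b' ∈ univ.erase a, (Real.exp 2 * (κ + ρ)) ^ (2 * δ b') * (NV (δ b') + ND (δ b') + E (δ b')) +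
          2 * (ρ⁻¹ ^ (2 * q) * (Real.exp 1 * normV (SpaceTimeIdx (b * L) M × SectorLeg (sectorCount (d * k - 1))) κ ρ (fun m' => NV m' + ND m' + E m')) *
            (Real.exp 1 * α * normV (SpaceTimeIdx (b * L) M × SectorLeg (sectorCount (d * k - 1))) κ ρ (fun m' => NV m' + ND m' + E m') / κ ^ 2) ^ (N₀ - 1) /
              (1 - Real.exp 1 * α * normV (SpaceTimeIdx (b * L) M × SectorLeg (sectorCount (d * k - 1))) κ ρ (fun m' => NV m' + ND m' + E m') / κ ^ 2))) +
        Λ⁻¹ * (∑ n' ∈ Ico 2 N₀, (ρ⁻¹ ^ (2 * q) * κ⁻¹ ^ (2 * (n' - 1)) * (α ^ (n' - 1) * Real.exp n')) *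
            ∑ δ ∈ (Fintype.piFinset fun _ : Fin n' => range (Fintype.card (SpaceTimeIdx (b * L) M × SectorLeg (sectorCount (d * k - 1))) / 2 + 1)) with 2 * q + 2 * (n' - 1) ≤ ∑ a, 2 * δ a,
              ∑ a, (Real.exp 2 * (κ + ρ)) ^ (2 * δ a) * ND (δ a) *
                ∏ b' ∈ univ.erase a, (Real.exp 2 * (κ + ρ)) ^ (2 * δ b') * (NV (δ b') + ND (δ b')) +
          Λ * (2 * (ρ⁻¹ ^ (2 * q) * (Real.exp 1 * normV (SpaceTimeIdx (b * L) M × SectorLeg (sectorCount (d * k - 1))) κ ρ (fun m' => NV m' + ND m')) *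
            (Real.exp 1 * α * normV (SpaceTimeIdx (b * L) M × SectorLeg (sectorCount (d * k - 1))) κ ρ (fun m' => NV m' + ND m') / κ ^ 2) ^ (N₀ - 1) /
              (1 - Real.exp 1 * α * normV (SpaceTimeIdx (b * L) M × SectorLeg (sectorCount (d * k - 1))) κ ρ (fun m' => NV m' + ND m') / κ ^ 2))))) +
        cW / (1 + ΛT * ((r : ℝ) + 1)) * (∑ n' ∈ Ico 2 N₀, (ρ⁻¹ ^ (2 * q) * κ⁻¹ ^ (2 * (n' - 1)) * (α ^ (n' - 1) * Real.exp n')) *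
            ∑ δ ∈ (Fintype.piFinset fun _ : Fin n' => range (Fintype.card (SpaceTimeIdx (b * L) M × SectorLeg (sectorCount (d * k - 1))) / 2 + 1)) with 2 * q + 2 * (n' - 1) ≤ ∑ a, 2 * δ a,
              ∑ a, (Real.exp 2 * (κ + ρ)) ^ (2 * δ a) * ND (δ a) *
                ∏ b' ∈ univ.erase a, (Real.exp 2 * (κ + ρ)) ^ (2 * δ b') * (NV (δ b') + ND (δ b')) +
          2 * (ρ⁻¹ ^ (2 * q) * (Real.exp 1 * normV (SpaceTimeIdx (b * L) M × SectorLeg (sectorCount (d * k - 1))) κ ρ (fun m' => NV m' + ND m')) *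
            (Real.exp 1 * α * normV (SpaceTimeIdx (b * L) M × SectorLeg (sectorCount (d * k - 1))) κ ρ (fun m' => NV m' + ND m') / κ ^ 2) ^ (N₀ - 1) /
              (1 - Real.exp 1 * α * normV (SpaceTimeIdx (b * L) M × SectorLeg (sectorCount (d * k - 1))) κ ρ (fun m' => NV m' + ND m') / κ ^ 2)))) +
      (cW ^ n * (cW * Es + cW / (1 + ΛT * ((r : ℝ) + 1)) * NDs) +
        (2 * cW ^ n * (cW / (1 + ΛT * ((r : ℝ) + 1))) * N + n * cW ^ n * (5 * (cW / (1 + ΛT * ((r : ℝ) + 1))) * N + 2 * cW * Nfar))) := by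
  have hwd : ∀ j, D₀ + r ≤ (w''.1.2 j).val % L ∧ (w''.1.2 j).val % L + (D₀ + r) < L := mem_klDeepPins.1 hw''
  refine sum_pinned_norm_kernel_klLipBornDiff_le_of_parts hβ.ne' U μ K hdk hZf hZc p w'' ?_ ?_
  · -- LIP: the weighted deep block-step door, `E := klLipInputDiffSup … R`, near pins `tnorm ≤ r`, transfer rows from the `klScaleWt` rows
    rw [← klLipInput_fine_eq]
    have hrowT' : ∀ x : SpaceTimeIdx (b * L) M × SectorLeg (sectorCount (d * k)),
        ∑ y', ‖klLipTransfer (b * L) M β μ K d k x y'‖ * (1 + ΛT * (Torus.tnorm (x.1.2 - y'.1.2) : ℝ)) ≤ cW := fun x => by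
      refine (sum_le_sum fun y' _ => ?_).trans (hrowT x)
      exact mul_le_mul_of_nonneg_left
        (one_add_mul_tnorm_le_klScaleWt_pair hβ.le hΛr ((x.1, y'.2) : SpaceTimeIdx (b * L) M × SectorLeg (sectorCount (d * k - 1))) y') (norm_nonneg _)
    have hcolT' : ∀ y' : SpaceTimeIdx (b * L) M × SectorLeg (sectorCount (d * k - 1)),
        ∑ x, ‖klLipTransfer (b * L) M β μ K d k x y'‖ * (1 + ΛT * (Torus.tnorm (x.1.2 - y'.1.2) : ℝ)) ≤ cW := fun y' => by
      refine (sum_le_sum fun x _ => ?_).trans (hcolT y')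
      exact mul_le_mul_of_nonneg_left
        (one_add_mul_tnorm_le_klScaleWt_pair hβ.le hΛr ((x.1, y'.2) : SpaceTimeIdx (b * L) M × SectorLeg (sectorCount (d * k - 1))) y') (norm_nonneg _)
    have hcolH := transfer_col_le (fun x : SpaceTimeIdx (b * L) M × SectorLeg (sectorCount (d * k)) => x.1.2)
      (fun y' : SpaceTimeIdx (b * L) M × SectorLeg (sectorCount (d * k - 1)) => y'.1.2) (klLipTransfer (b * L) M β μ K d k) hΛT hcolT'
    have hrowH := transfer_rowF_le (fun x : SpaceTimeIdx (b * L) M × SectorLeg (sectorCount (d * k)) => x.1.2)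
      (fun y' : SpaceTimeIdx (b * L) M × SectorLeg (sectorCount (d * k - 1)) => y'.1.2) (klLipTransfer (b * L) M β μ K d k) hΛT hrowT' r w''
    have hτH := transfer_tauF_le (fun x : SpaceTimeIdx (b * L) M × SectorLeg (sectorCount (d * k)) => x.1.2)
      (fun y' : SpaceTimeIdx (b * L) M × SectorLeg (sectorCount (d * k - 1)) => y'.1.2) (klLipTransfer (b * L) M β μ K d k) hΛT hrowT' hcW (le_refl r) w''
    refine le_of_eq_of_le (sum_pinned_norm_kernel_congr_deg _ hq p w'').symm ?_
    exact lipBlockStep_deep_le hβ U μ K hZf hZc hκ hGB NV ND E hNV0 hND0 hE0 hNV hND R R'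
      (fun m' j x hx => (sum_pinned_norm_kernel_inputDiff_le_sup β U μ K d k (2 * m') R j hx).trans (hE m')) hα hrow hcol hρ hθ₁ hθ₂ hN₀
      (fun y' => Torus.tnorm (w''.1.2 - y'.1.2) ≤ r) (fun y' hy' => klDeepPins_mono hRR' (mem_klDeepPins_of_tnorm_le hwd hy')) hcW hcolH w'' hrowH hτH
      hΛ0 hΛle (Fin.cast hq.symm p)
  · -- SRC: the transfer door at `klLipTransfer`, rows discharged; `Es` read at the `D₀`-deep near pins
    exact lipSourceTransfer_le_of_scaleWtRows hβ U μ K hdk jr hZc hΛT hΛr hcW hrowT hcolT p w'' D₀ r hD₀ hwd hN0 hNfar0 hEs0 hNDs0 (hN p) (hNfar p)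
      (fun y' hy' => hEs p y' (mem_klDeepPins_of_tnorm_le hwd hy')) (hNDs p)

/-- **The (Db) row in sup form, free profile** (`klLipBornDiffSup_le_step` with any majorant `E` of the deep-pin input sizes).  Original docstring:  Under the hypotheses of `klLipBornDiff_pinned_le_step` (all of them uniform in the output pin), the deep-pin size of the born
difference of block `k` in degree `n + 1 = 2q` at depth `D₀ + r` is at most any `B ≥ 0` dominating LIP + SRC — `…LipDiffSups.klLipBornDiffSup_le_of_forall`.
(The law-unit reading of `B` is F-D5c′; with `…LipRemeasureSup.klLipInputDiffSup_le_remeasured` this is the `hstep` / `hdμ` pair of `EngineV8.towerBornDiff_le_law₄`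
in absolute units.) -/
theorem klLipBornDiffSup_le_step_of_profile {β : ℝ} (hβ : 0 < β) (U μ : ℝ) (K : TrigPolyC4v) {d k : ℕ} (hdk : 1 ≤ d * k)
    (hZf : hubbardEffPartitionFnCT (b * L) M β U μ 0 K (klScale klE0 (d * k)) ≠ 0)
    (hZc : hubbardEffPartitionFnCT L M β U μ 0 K (klScale klE0 (d * k)) ≠ 0)
    {κ : ℝ} (hκ : 0 < κ) (hGB : IsGramBoundedR ((sectorSubMatrix (b * L) M β (bgmFatMultiplier (b * L) M klE0 β (nambuXiCT (b * L) μ K) (d * k - 1))).transpose * hubbardCovSliceCT (b * L) M β μ 0 K (klScale klE0 (d * (k + 1))) (klScale klE0 (d * k)) * sectorSubMatrix (b * L) M β (bgmFatMultiplier (b * L) M klE0 β (nambuXiCT (b * L) μ K) (d * k - 1))) κ)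
    (NV ND : ℕ → ℝ) (hNV0 : ∀ m', 0 ≤ NV m') (hND0 : ∀ m', 0 ≤ ND m')
    (hNV : ∀ m' (j : Fin (2 * m')) (x : (SpaceTimeIdx (b * L) M × SectorLeg (sectorCount (d * k - 1)))), ∑ Y ∈ univ.filter (fun Y : Fin (2 * m') → (SpaceTimeIdx (b * L) M × SectorLeg (sectorCount (d * k - 1))) => Y j = x),
      ‖kernel ℂ (klGlue L b M (sectorCount (d * k - 1)) (klLipInput L M β U μ K d k)) (2 * m') Y‖ * klGluedWt L b M β (d * k - 1) (sectorCount (d * k - 1)) (univ.image Y) ≤ NV m')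
    (hND : ∀ m' (j : Fin (2 * m')) (x : (SpaceTimeIdx (b * L) M × SectorLeg (sectorCount (d * k - 1)))), ∑ Y ∈ univ.filter (fun Y : Fin (2 * m') → (SpaceTimeIdx (b * L) M × SectorLeg (sectorCount (d * k - 1))) => Y j = x),
      ‖kernel ℂ (klLipInputDiff L b M β U μ K d k) (2 * m') Y‖ * klGluedWt L b M β (d * k - 1) (sectorCount (d * k - 1)) (univ.image Y) ≤ ND m')
    (R R' : ℕ) (E : ℕ → ℝ) (hE0 : ∀ m', 0 ≤ E m') (hE : ∀ m', klLipInputDiffSup L b M β U μ K d k (2 * m') R ≤ E m')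
    {α : ℝ} (hα : 0 < α)
    (hrow : ∀ X, ∑ Y, ‖((sectorSubMatrix (b * L) M β (bgmFatMultiplier (b * L) M klE0 β (nambuXiCT (b * L) μ K) (d * k - 1))).transpose * hubbardCovSliceCT (b * L) M β μ 0 K (klScale klE0 (d * (k + 1))) (klScale klE0 (d * k)) * sectorSubMatrix (b * L) M β (bgmFatMultiplier (b * L) M klE0 β (nambuXiCT (b * L) μ K) (d * k - 1))) X Y‖ * klGluedWt L b M β (d * k - 1) (sectorCount (d * k - 1)) {X, Y} ≤ α)
    (hcol : ∀ Y, ∑ X, ‖((sectorSubMatrix (b * L) M β (bgmFatMultiplier (b * L) M klE0 β (nambuXiCT (b * L) μ K) (d * k - 1))).transpose * hubbardCovSliceCT (b * L) M β μ 0 K (klScale klE0 (d * (k + 1))) (klScale klE0 (d * k)) * sectorSubMatrix (b * L) M β (bgmFatMultiplier (b * L) M klE0 β (nambuXiCT (b * L) μ K) (d * k - 1))) X Y‖ * klGluedWt L b M β (d * k - 1) (sectorCount (d * k - 1)) {X, Y} ≤ α)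
    {ρ : ℝ} (hρ : 0 < ρ)
    (hθ₁ : Real.exp 1 * α * normV (SpaceTimeIdx (b * L) M × SectorLeg (sectorCount (d * k - 1))) κ ρ (fun m' => NV m' + ND m' + E m') / κ ^ 2 < 1)
    (hθ₂ : Real.exp 1 * α * normV (SpaceTimeIdx (b * L) M × SectorLeg (sectorCount (d * k - 1))) κ ρ (fun m' => NV m' + ND m') / κ ^ 2 < 1)
    {N₀ : ℕ} (hN₀ : 2 ≤ N₀)
    {Λ : ℝ} (hΛ0 : 0 < Λ) (hΛle : Λ ≤ 1 + klScale klE0 (d * k - 1) * ((R' : ℝ) + 1))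
    (jr : ℕ) {ΛT cW : ℝ} (hΛT : 0 ≤ ΛT) (hΛr : ΛT ≤ klScale klE0 jr) (hcW : 0 ≤ cW)
    (hrowT : ∀ x, ∑ y', ‖klLipTransfer (b * L) M β μ K d k x y'‖ *
      klScaleWt (b * L) M β jr {latticeLegPos (2 * (2 * M)) x, latticeLegPos (2 * (2 * M)) y'} ≤ cW)
    (hcolT : ∀ y', ∑ x, ‖klLipTransfer (b * L) M β μ K d k x y'‖ *
      klScaleWt (b * L) M β jr {latticeLegPos (2 * (2 * M)) x, latticeLegPos (2 * (2 * M)) y'} ≤ cW)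
    (D₀ r : ℕ) (hD₀ : 2 * r ≤ D₀) (hRR' : R + R' ≤ D₀)
    {n q : ℕ} (hq : 2 * q = n + 1)
    {N Nfar Es NDs : ℝ} (hN0 : 0 ≤ N) (hNfar0 : 0 ≤ Nfar) (hEs0 : 0 ≤ Es) (hNDs0 : 0 ≤ NDs)
    (hN : ∀ (p : Fin (n + 1)) y, ∑ Y ∈ univ.filter (fun Y : Fin (n + 1) → SpaceTimeIdx L M × SectorLeg (sectorCount (d * k - 1)) => Y p = y),
      ‖kernel ℂ (effAction ℂ (klLipCov L M β μ K d k) (klLipInput L M β U μ K d k) - klLipInput L M β U μ K d k) (n + 1) Y‖ ≤ N)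
    (hNfar : ∀ (p : Fin (n + 1)) y (i : Fin (n + 1)),
      ∑ Y ∈ univ.filter (fun Y : Fin (n + 1) → SpaceTimeIdx L M × SectorLeg (sectorCount (d * k - 1)) => Y p = y ∧ r < Torus.tnorm ((Y p).1.2 - (Y i).1.2)),
        ‖kernel ℂ (effAction ℂ (klLipCov L M β μ K d k) (klLipInput L M β U μ K d k) - klLipInput L M β U μ K d k) (n + 1) Y‖ ≤ Nfar)
    (hEs : ∀ (p : Fin (n + 1)) (y' : SpaceTimeIdx (b * L) M × SectorLeg (sectorCount (d * k - 1))), y' ∈ klDeepPins L D₀ →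
      ∑ Y' ∈ univ.filter (fun Y' : Fin (n + 1) → SpaceTimeIdx (b * L) M × SectorLeg (sectorCount (d * k - 1)) => Y' p = y'),
        ‖kernel ℂ ((effAction ℂ (klLipCov (b * L) M β μ K d k) (klGlue L b M (sectorCount (d * k - 1)) (klLipInput L M β U μ K d k)) -
              klGlue L b M (sectorCount (d * k - 1)) (klLipInput L M β U μ K d k)) -
            klGlue L b M (sectorCount (d * k - 1))
              (effAction ℂ (klLipCov L M β μ K d k) (klLipInput L M β U μ K d k) - klLipInput L M β U μ K d k)) (n + 1) Y'‖ ≤ Es)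
    (hNDs : ∀ (p : Fin (n + 1)) (y' : SpaceTimeIdx (b * L) M × SectorLeg (sectorCount (d * k - 1))),
      ∑ Y' ∈ univ.filter (fun Y' : Fin (n + 1) → SpaceTimeIdx (b * L) M × SectorLeg (sectorCount (d * k - 1)) => Y' p = y'),
        ‖kernel ℂ ((effAction ℂ (klLipCov (b * L) M β μ K d k) (klGlue L b M (sectorCount (d * k - 1)) (klLipInput L M β U μ K d k)) -
              klGlue L b M (sectorCount (d * k - 1)) (klLipInput L M β U μ K d k)) -
            klGlue L b M (sectorCount (d * k - 1))
              (effAction ℂ (klLipCov L M β μ K d k) (klLipInput L M β U μ K d k) - klLipInput L M β U μ K d k)) (n + 1) Y'‖ ≤ NDs)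
    {B : ℝ} (hB0 : 0 ≤ B)
    (hB :
      cW ^ (2 * q - 1) * (cW *
        ((∑ m' ∈ range (Fintype.card (SpaceTimeIdx (b * L) M × SectorLeg (sectorCount (d * k - 1))) / 2 + 1), if q < m' then ((2 * m').choose (2 * q) : ℝ) * κ ^ (2 * m' - 2 * q) * E m' else 0) +
          Λ⁻¹ * ∑ m' ∈ range (Fintype.card (SpaceTimeIdx (b * L) M × SectorLeg (sectorCount (d * k - 1))) / 2 + 1),
            if q < m' then ((2 * m').choose (2 * q) : ℝ) * κ ^ (2 * m' - 2 * q) * ND m' else 0) +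
        cW / (1 + ΛT * ((r : ℝ) + 1)) * ∑ m' ∈ range (Fintype.card (SpaceTimeIdx (b * L) M × SectorLeg (sectorCount (d * k - 1))) / 2 + 1), if q < m' then ((2 * m').choose (2 * q) : ℝ) * κ ^ (2 * m' - 2 * q) * ND m' else 0) +
      cW ^ (2 * q - 1) * (cW *
        ((∑ n' ∈ Ico 2 N₀, (ρ⁻¹ ^ (2 * q) * κ⁻¹ ^ (2 * (n' - 1)) * (α ^ (n' - 1) * Real.exp n')) *
            ∑ δ ∈ (Fintype.piFinset fun _ : Fin n' => range (Fintype.card (SpaceTimeIdx (b * L) M × SectorLeg (sectorCount (d * k - 1))) / 2 + 1)) with 2 * q + 2 * (n' - 1) ≤ ∑ a, 2 * δ a,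
              ∑ a, (Real.exp 2 * (κ + ρ)) ^ (2 * δ a) * E (δ a) *
                ∏ b' ∈ univ.erase a, (Real.exp 2 * (κ + ρ)) ^ (2 * δ b') * (NV (δ b') + ND (δ b') + E (δ b')) +
          2 * (ρ⁻¹ ^ (2 * q) * (Real.exp 1 * normV (SpaceTimeIdx (b * L) M × SectorLeg (sectorCount (d * k - 1))) κ ρ (fun m' => NV m' + ND m' + E m')) *
            (Real.exp 1 * α * normV (SpaceTimeIdx (b * L) M × SectorLeg (sectorCount (d * k - 1))) κ ρ (fun m' => NV m' + ND m' + E m') / κ ^ 2) ^ (N₀ - 1) /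
              (1 - Real.exp 1 * α * normV (SpaceTimeIdx (b * L) M × SectorLeg (sectorCount (d * k - 1))) κ ρ (fun m' => NV m' + ND m' + E m') / κ ^ 2))) +
        Λ⁻¹ * (∑ n' ∈ Ico 2 N₀, (ρ⁻¹ ^ (2 * q) * κ⁻¹ ^ (2 * (n' - 1)) * (α ^ (n' - 1) * Real.exp n')) *
            ∑ δ ∈ (Fintype.piFinset fun _ : Fin n' => range (Fintype.card (SpaceTimeIdx (b * L) M × SectorLeg (sectorCount (d * k - 1))) / 2 + 1)) with 2 * q + 2 * (n' - 1) ≤ ∑ a, 2 * δ a,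
              ∑ a, (Real.exp 2 * (κ + ρ)) ^ (2 * δ a) * ND (δ a) *
                ∏ b' ∈ univ.erase a, (Real.exp 2 * (κ + ρ)) ^ (2 * δ b') * (NV (δ b') + ND (δ b')) +
          Λ * (2 * (ρ⁻¹ ^ (2 * q) * (Real.exp 1 * normV (SpaceTimeIdx (b * L) M × SectorLeg (sectorCount (d * k - 1))) κ ρ (fun m' => NV m' + ND m')) *
            (Real.exp 1 * α * normV (SpaceTimeIdx (b * L) M × SectorLeg (sectorCount (d * k - 1))) κ ρ (fun m' => NV m' + ND m') / κ ^ 2) ^ (N₀ - 1) /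
              (1 - Real.exp 1 * α * normV (SpaceTimeIdx (b * L) M × SectorLeg (sectorCount (d * k - 1))) κ ρ (fun m' => NV m' + ND m') / κ ^ 2))))) +
        cW / (1 + ΛT * ((r : ℝ) + 1)) * (∑ n' ∈ Ico 2 N₀, (ρ⁻¹ ^ (2 * q) * κ⁻¹ ^ (2 * (n' - 1)) * (α ^ (n' - 1) * Real.exp n')) *
            ∑ δ ∈ (Fintype.piFinset fun _ : Fin n' => range (Fintype.card (SpaceTimeIdx (b * L) M × SectorLeg (sectorCount (d * k - 1))) / 2 + 1)) with 2 * q + 2 * (n' - 1) ≤ ∑ a, 2 * δ a,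
              ∑ a, (Real.exp 2 * (κ + ρ)) ^ (2 * δ a) * ND (δ a) *
                ∏ b' ∈ univ.erase a, (Real.exp 2 * (κ + ρ)) ^ (2 * δ b') * (NV (δ b') + ND (δ b')) +
          2 * (ρ⁻¹ ^ (2 * q) * (Real.exp 1 * normV (SpaceTimeIdx (b * L) M × SectorLeg (sectorCount (d * k - 1))) κ ρ (fun m' => NV m' + ND m')) *
            (Real.exp 1 * α * normV (SpaceTimeIdx (b * L) M × SectorLeg (sectorCount (d * k - 1))) κ ρ (fun m' => NV m' + ND m') / κ ^ 2) ^ (N₀ - 1) /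
              (1 - Real.exp 1 * α * normV (SpaceTimeIdx (b * L) M × SectorLeg (sectorCount (d * k - 1))) κ ρ (fun m' => NV m' + ND m') / κ ^ 2)))) +
      (cW ^ n * (cW * Es + cW / (1 + ΛT * ((r : ℝ) + 1)) * NDs) +
        (2 * cW ^ n * (cW / (1 + ΛT * ((r : ℝ) + 1))) * N + n * cW ^ n * (5 * (cW / (1 + ΛT * ((r : ℝ) + 1))) * N + 2 * cW * Nfar))) ≤ B) :
    klLipBornDiffSup L b M β U μ K d k (n + 1) (D₀ + r) ≤ B :=
  klLipBornDiffSup_le_of_forall β U μ K d k (n + 1) (D₀ + r) hB0 fun p w'' hw'' =>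
    (klLipBornDiff_pinned_le_step_of_profile hβ U μ K hdk hZf hZc hκ hGB NV ND hNV0 hND0 hNV hND R R' E hE0 hE hα hrow hcol hρ hθ₁ hθ₂ hN₀ hΛ0 hΛle jr hΛT hΛr
      hcW hrowT hcolT D₀ r hD₀ hRR' hq hN0 hNfar0 hEs0 hNDs0 hN hNfar hEs hNDs p w'' hw'').trans hB

end Summit.HubbardSuperconductivity.HubbardSuperconductivity.Theorems.TwoVolumeLip

end
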